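import Summits.AnomalousDissipation.AnomalousDissipation.Theorems.SawtoothPulseCascadeK1LocalisedCascadeKHLineKernel
import Mathlib.Analysis.Fourier.AddCircle
import Mathlib.Analysis.PSeries
import Mathlib.Analysis.SpecialFunctions.Integrals.Basic

/-!
# K2 lane (route-2 `SawtoothPulseCascade`, crux dir `K1LocalisedCascade`): the periodised line kernel as a FOURIER SERIES — Mittag-Leffler sums of the line family

Helper file of the K2 lane (ACL item stmt-AnomalousDissipation-19491), serving planner p4's typed slot map (`energy`, `coeff`: the energy of a
lamination state is `Σ_n |ζ̂(n)|²/(4π²(a² + (β+n)²))`). For `a > 0`, `κ = 2πa`, `z = e^{2πiβ}`, `q = e^{−κ}`, the periodised Biot–Savart kernel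
of the family `(a, β)` on `y = r ∈ [0,1)` is `G(r) = −(e^{−κr}/(1 − z̄q) + z e^{κ(r−1)}/(1 − zq))/(2κ)` (closed form of the lattice sum
`Σ_n e^{2πiβn}·(−e^{−κ|r−n|}/(2κ))`, tree `lineKernel_hasSum` p685844). Proved here:
* `lineKernel_coeff`: `∫₀¹ e^{−2πi(β+m)x} G(x) dx = −1/((2π)²(a² + (β+m)²))` for every `m ∈ ℤ` (the Fourier transform of `g(y) = −e^{−κ|y|}/(2κ)`
  at `ξ = β + m`, computed on ONE period from the closed form: the factors `1 − z̄q`, `1 − zq` cancel exactly);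
* `lineKernel_fourier_hasSum`: **`G(y) = −Σ_{m∈ℤ} e^{2πi(β+m)y}/((2π)²(a² + (β+m)²))`** as a `HasSum` over `ℤ`, `y ∈ [0,1)` (Mathlib's pointwise
  Fourier series of the continuous `1`-periodic function `e^{−2πiβy}G(y)` with summable coefficients);
* the two MITTAG-LEFFLER sums the sheet energy needs: `hasSum_lineWeights` (`Σ_m 1/(4π²(a²+(β+m)²)) = −Σ₀(a,β)/(2π)`, via `twoPi_lineKernel_zero`)
  and `hasSum_lineWeights_half` / `hasSum_lineWeights_half'` (`Σ_m e^{±iπ(β+m)}/(4π²(a²+(β+m)²)) = −conj S_β(a)/(2π)`, `−S_β(a)/(2π)`, via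
  `twoPi_conj_lineKernel_half`).
No definitions; no statement about the crux. [cite: Drazin2002, §8.3 (8.36)–(8.38)] [problem: turb]
-/

-- `Summit.<Summit>.<Problem>`: single-conjunct summit, the duplicate namespace segment is deliberate.
set_option linter.dupNamespace false

noncomputable section

namespace Summit.AnomalousDissipation.AnomalousDissipation.Theorems.SawtoothPulseCascade.K2PhaseBudget

open Set MeasureTheory intervalIntegral Literature.Analysis.FluidPDE.SawtoothCascade

/-! ## §1 Characters -/

/-- `e^{−2πim} = 1` for `m ∈ ℤ`. [folklore] -/
theorem cexp_neg_two_pi_int_mul_I (m : ℤ) : Complex.exp (-(2 * Real.pi * (m : ℂ) * Complex.I)) = 1 := by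
  have h := Complex.exp_int_mul_two_pi_mul_I (-m)
  rw [← h]; congr 1; push_cast; ring

/-- `e^{−2πi(β+m)} = conj z` for `z = e^{2πiβ}`, `m ∈ ℤ`. [folklore] -/
theorem cexp_neg_two_pi_add_int (β : ℝ) (m : ℤ) :
    Complex.exp (-(2 * Real.pi * ((β : ℂ) + m) * Complex.I)) = starRingEnd ℂ (Complex.exp (2 * Real.pi * β * Complex.I)) := by
  rw [conj_blochZ', show -(2 * Real.pi * ((β : ℂ) + m) * Complex.I) = -(2 * Real.pi * β * Complex.I) + -(2 * Real.pi * (m : ℂ) * Complex.I) by ring,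
    Complex.exp_add, cexp_neg_two_pi_int_mul_I, mul_one]
where
  /-- `conj e^{2πiβ} = e^{−2πiβ}` (local copy of `conj_blochZ`). [folklore] -/
  conj_blochZ' : starRingEnd ℂ (Complex.exp (2 * Real.pi * β * Complex.I)) = Complex.exp (-(2 * Real.pi * β * Complex.I)) := by
    rw [← Complex.exp_conj]; congr 1
    simp only [map_mul, map_ofNat, Complex.conj_ofReal, Complex.conj_I]; ring

/-! ## §2 The Fourier coefficients of the kernel on one period -/

/-- **`∫₀¹ e^{−2πi(β+m)x} G_{a,β}(x) dx = −1/((2π)²(a² + (β+m)²))`** (`a > 0`, `m ∈ ℤ`): the `m`-th Fourier coefficient of the `1`-periodic function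
`e^{−2πiβx}G(x)` is the Fourier transform of `g(y) = −e^{−2πa|y|}/(4πa)` at `β + m`. [cite: Drazin2002, §8.3 (8.36)–(8.38)] -/
theorem lineKernel_coeff {a : ℝ} (ha : 0 < a) (β : ℝ) (m : ℤ) {K : ℝ → ℂ}
    (hK : K = fun r : ℝ => (-((Real.exp (-(2 * Real.pi * a * r)) : ℂ) /
            (1 - starRingEnd ℂ (Complex.exp (2 * Real.pi * β * Complex.I)) * (Real.exp (-(2 * Real.pi * a)) : ℂ))
          + (Real.exp (2 * Real.pi * a * (r - 1)) : ℂ) * Complex.exp (2 * Real.pi * β * Complex.I) /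
            (1 - Complex.exp (2 * Real.pi * β * Complex.I) * (Real.exp (-(2 * Real.pi * a)) : ℂ))) /
        (2 * (2 * Real.pi * a) : ℂ))) :
    ∫ x in (0 : ℝ)..1, Complex.exp (-(2 * Real.pi * ((β : ℂ) + m) * x * Complex.I)) * K x =
      -(((1 / (4 * Real.pi ^ 2 * (a ^ 2 + (β + m) ^ 2)) : ℝ) : ℂ)) := by
  -- the weight as `−1/(κ² + ω²)`, `κ = 2πa`, `ω = 2π(β+m)`
  have hA : (0 : ℝ) < a ^ 2 + (β + m) ^ 2 := by positivity
  rw [show -(((1 / (4 * Real.pi ^ 2 * (a ^ 2 + (β + m) ^ 2)) : ℝ) : ℂ)) =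
      -1 / ((((2 * Real.pi * a) ^ 2 + (2 * Real.pi * (β + m)) ^ 2 : ℝ)) : ℂ) by
    have h1 : (4 * Real.pi ^ 2 * (a ^ 2 + (β + m) ^ 2) : ℝ) = (2 * Real.pi * a) ^ 2 + (2 * Real.pi * (β + m)) ^ 2 := by ring
    rw [h1, Complex.ofReal_div, Complex.ofReal_one, neg_div]]
  set z : ℂ := Complex.exp (2 * Real.pi * β * Complex.I) with hz
  set w : ℂ := starRingEnd ℂ z with hw
  set q : ℝ := Real.exp (-(2 * Real.pi * a)) with hq
  set κ : ℝ := 2 * Real.pi * a with hκ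
  set ω : ℝ := 2 * Real.pi * (β + m) with hω
  have hπ := Real.pi_pos
  have hκ0 : 0 < κ := by positivity
  have hzn : ‖z‖ = 1 := by
    rw [hz, show (2 * Real.pi * β * Complex.I : ℂ) = ((2 * Real.pi * β : ℝ) : ℂ) * Complex.I by push_cast; ring]
    exact Complex.norm_exp_ofReal_mul_I _
  have hwn : ‖w‖ = 1 := by rw [hw, Complex.norm_conj]; exact hzn
  have hzw : z * w = 1 := by
    rw [hw, Complex.mul_conj, Complex.normSq_eq_norm_sq, hzn]; simp
  have hq0 : 0 < q := Real.exp_pos _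
  have hq1 : q < 1 := by rw [hq]; exact Real.exp_lt_one_iff.2 (by nlinarith)
  have hd1 : 1 - w * (q : ℂ) ≠ 0 := one_sub_mul_ne_zero hwn hq0.le hq1
  have hd2 : 1 - z * (q : ℂ) ≠ 0 := one_sub_mul_ne_zero hzn hq0.le hq1
  have hqe : (q : ℂ) * Complex.exp (κ : ℂ) = 1 := by
    rw [hq, Complex.ofReal_exp, ← Complex.exp_add]; push_cast
    rw [neg_add_cancel, Complex.exp_zero]
  -- the two exponents
  set d₁ : ℂ := -(κ : ℂ) - (ω : ℂ) * Complex.I with hd₁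
  set d₂ : ℂ := (κ : ℂ) - (ω : ℂ) * Complex.I with hd₂
  have hd₁0 : d₁ ≠ 0 := by
    intro h; have := congrArg Complex.re h
    simp [hd₁] at this; exact hκ0.ne' (by linarith)
  have hd₂0 : d₂ ≠ 0 := by
    intro h; have := congrArg Complex.re h
    simp [hd₂] at this; exact hκ0.ne' (by linarith)
  -- the integrand in exponential form
  set c₁ : ℂ := -1 / ((1 - w * (q : ℂ)) * (2 * κ)) with hc₁
  set c₂ : ℂ := -((q : ℂ) * z) / ((1 - z * (q : ℂ)) * (2 * κ)) with hc₂
  have hint : ∀ x : ℝ, Complex.exp (-(2 * Real.pi * ((β : ℂ) + m) * x * Complex.I)) * K x =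
      c₁ * Complex.exp (d₁ * x) + c₂ * Complex.exp (d₂ * x) := by
    intro x
    have e1 : (Real.exp (-(2 * Real.pi * a * x)) : ℂ) = Complex.exp (-(κ : ℂ) * x) := by
      rw [Complex.ofReal_exp]; congr 1; rw [hκ]; push_cast; ring
    have e2 : (Real.exp (2 * Real.pi * a * (x - 1)) : ℂ) = (q : ℂ) * Complex.exp ((κ : ℂ) * x) := by
      rw [hq, Complex.ofReal_exp, Complex.ofReal_exp, ← Complex.exp_add]; congr 1; rw [hκ]; push_cast; ring
    have e3 : Complex.exp (-(2 * Real.pi * ((β : ℂ) + m) * x * Complex.I)) = Complex.exp (-(ω : ℂ) * Complex.I * x) := by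
      congr 1; rw [hω]; push_cast; ring
    have eK : K x = -(Complex.exp (-(κ : ℂ) * x) / (1 - w * (q : ℂ)) + (q : ℂ) * Complex.exp ((κ : ℂ) * x) * z / (1 - z * (q : ℂ))) /
        (2 * κ : ℂ) := by
      simp only [hK]; rw [e1, e2]; rw [hκ]; push_cast; rfl
    rw [eK, e3, hc₁, hc₂, hd₁, hd₂]
    have f1 : Complex.exp (-(ω : ℂ) * Complex.I * x) * Complex.exp (-(κ : ℂ) * x) = Complex.exp ((-(κ : ℂ) - (ω : ℂ) * Complex.I) * x) := by
      rw [← Complex.exp_add]; congr 1; ring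
    have f2 : Complex.exp (-(ω : ℂ) * Complex.I * x) * Complex.exp ((κ : ℂ) * x) = Complex.exp (((κ : ℂ) - (ω : ℂ) * Complex.I) * x) := by
      rw [← Complex.exp_add]; congr 1; ring
    rw [← f1, ← f2]
    have hκc : (κ : ℂ) ≠ 0 := by exact_mod_cast hκ0.ne'
    field_simp
    ring
  -- integrate
  have hI : ∫ x in (0 : ℝ)..1, Complex.exp (-(2 * Real.pi * ((β : ℂ) + m) * x * Complex.I)) * K x =
      c₁ * ((Complex.exp (d₁ * (1 : ℝ)) - Complex.exp (d₁ * (0 : ℝ))) / d₁) +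
        c₂ * ((Complex.exp (d₂ * (1 : ℝ)) - Complex.exp (d₂ * (0 : ℝ))) / d₂) := by
    rw [intervalIntegral.integral_congr (fun x _ => hint x)]
    rw [intervalIntegral.integral_add, intervalIntegral.integral_const_mul, intervalIntegral.integral_const_mul,
      integral_exp_mul_complex hd₁0, integral_exp_mul_complex hd₂0]
    · exact ((Complex.continuous_exp.comp (continuous_const.mul Complex.continuous_ofReal)).const_mul _).intervalIntegrable _ _
    · exact ((Complex.continuous_exp.comp (continuous_const.mul Complex.continuous_ofReal)).const_mul _).intervalIntegrable _ _
  rw [hI]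
  -- values of the exponentials at the endpoints
  have hωe : Complex.exp (-(ω : ℂ) * Complex.I) = w := by
    rw [hw, hz, ← cexp_neg_two_pi_add_int β m]; congr 1; rw [hω]; push_cast; ring
  have v1 : Complex.exp (d₁ * (1 : ℝ)) = (q : ℂ) * w := by
    rw [hd₁, hq, Complex.ofReal_exp, ← hωe, ← Complex.exp_add]; congr 1; rw [hκ]; push_cast; ring
  have v2 : Complex.exp (d₂ * (1 : ℝ)) = Complex.exp (κ : ℂ) * w := by
    rw [hd₂, ← hωe, ← Complex.exp_add]; congr 1; push_cast; ring
  rw [v1, v2, show Complex.exp (d₁ * (0 : ℝ)) = 1 by simp, show Complex.exp (d₂ * (0 : ℝ)) = 1 by simp]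
  -- pure algebra now: `κ² + ω² = (κ + iω)(κ − iω)`
  have hden : ((((2 * Real.pi * a) ^ 2 + (2 * Real.pi * (β + m)) ^ 2 : ℝ)) : ℂ) = (κ : ℂ) ^ 2 + (ω : ℂ) ^ 2 := by
    rw [hκ, hω]; push_cast; ring
  rw [hden]
  have hκc : (κ : ℂ) ≠ 0 := by exact_mod_cast hκ0.ne'
  have hp : (κ : ℂ) + (ω : ℂ) * Complex.I ≠ 0 := by
    intro h; apply hd₁0; rw [hd₁]; linear_combination -h
  have hm' : (κ : ℂ) - (ω : ℂ) * Complex.I ≠ 0 := hd₂0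
  have T1 : -1 / ((1 - w * (q : ℂ)) * (2 * κ)) * (((q : ℂ) * w - 1) / (-(κ : ℂ) - (ω : ℂ) * Complex.I)) =
      -1 / ((2 * κ) * ((κ : ℂ) + (ω : ℂ) * Complex.I)) := by
    have hn : (-(κ : ℂ) - (ω : ℂ) * Complex.I) ≠ 0 := hd₁0
    field_simp
    ring
  have T2 : -((q : ℂ) * z) / ((1 - z * (q : ℂ)) * (2 * κ)) * ((Complex.exp (κ : ℂ) * w - 1) / ((κ : ℂ) - (ω : ℂ) * Complex.I)) =
      -1 / ((2 * κ) * ((κ : ℂ) - (ω : ℂ) * Complex.I)) := by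
    rw [div_mul_div_comm]
    have key : -((q : ℂ) * z) * (Complex.exp (κ : ℂ) * w - 1) = -1 * (1 - z * (q : ℂ)) := by
      linear_combination -(z * w) * hqe - hzw
    rw [key]
    field_simp
  rw [hc₁, hc₂, hd₁, hd₂, T1, T2]
  have hsum : (κ : ℂ) ^ 2 + (ω : ℂ) ^ 2 ≠ 0 := by
    have : (κ : ℂ) ^ 2 + (ω : ℂ) ^ 2 = ((κ : ℂ) + (ω : ℂ) * Complex.I) * ((κ : ℂ) - (ω : ℂ) * Complex.I) := by
      ring_nf; rw [Complex.I_sq]; ring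
    rw [this]; exact mul_ne_zero hp hm'
  rw [div_add_div _ _ (mul_ne_zero (mul_ne_zero two_ne_zero hκc) hp) (mul_ne_zero (mul_ne_zero two_ne_zero hκc) hm'),
    div_eq_div_iff (mul_ne_zero (mul_ne_zero (mul_ne_zero two_ne_zero hκc) hp) (mul_ne_zero (mul_ne_zero two_ne_zero hκc) hm')) hsum]
  linear_combination (-(4 : ℂ) * (κ : ℂ) ^ 2 * (ω : ℂ) ^ 2) * Complex.I_sq

/-! ## §3 Summability of the line weights -/

/-- `Σ_{m∈ℤ} 1/(a² + (β+m)²) < ∞` for `a ≠ 0` (comparison with Mathlib's `Σ_m |m+β|^{−2}` off the at most one index with `m + β = 0`). [folklore] -/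
theorem summable_lineWeights {a : ℝ} (ha : a ≠ 0) (β : ℝ) :
    Summable fun m : ℤ => 1 / (a ^ 2 + (β + m) ^ 2) := by
  have hg : Summable fun m : ℤ => 1 / |(m : ℝ) + β| ^ (2 : ℝ) :=
    (Real.summable_one_div_int_add_rpow β 2).2 (by norm_num)
  refine Summable.of_norm_bounded_eventually hg ?_
  have hfin : Set.Finite {m : ℤ | (m : ℝ) + β = 0} := by
    refine Set.Subsingleton.finite fun m hm m' hm' => ?_
    have : (m : ℝ) = m' := by
      simp only [Set.mem_setOf_eq] at hm hm'
      linarith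
    exact_mod_cast this
  refine (hfin.eventually_cofinite_notMem).mono fun m hm => ?_
  simp only [Set.mem_setOf_eq] at hm
  have ha2 : 0 < a ^ 2 := by positivity
  have hq : 0 < a ^ 2 + (β + m) ^ 2 := by positivity
  rw [Real.norm_eq_abs, abs_of_nonneg (by positivity)]
  have habs : 0 < |(m : ℝ) + β| := abs_pos.2 hm
  rw [one_div_le_one_div hq (Real.rpow_pos_of_pos habs _),
    show |(m : ℝ) + β| ^ (2 : ℝ) = ((m : ℝ) + β) ^ 2 by
      rw [show (2 : ℝ) = ((2 : ℕ) : ℝ) by norm_num, Real.rpow_natCast, sq_abs]]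
  nlinarith

/-- The complex form with a bounded phase: `Σ_m w_m·c_m` converges for the line weights `w_m = 1/(4π²(a² + (β+m)²))` and any `‖c_m‖ ≤ 1`
(`a ≠ 0`). [folklore] -/
theorem summable_lineWeights_mul {a : ℝ} (ha : a ≠ 0) (β : ℝ) {c : ℤ → ℂ} (hc : ∀ m, ‖c m‖ ≤ 1) :
    Summable fun m : ℤ => (((1 / (4 * Real.pi ^ 2 * (a ^ 2 + (β + m) ^ 2)) : ℝ) : ℂ)) * c m := by
  have h := ((summable_lineWeights ha β).mul_left (1 / (4 * Real.pi ^ 2)))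
  refine Summable.of_norm_bounded h (fun m => ?_)
  rw [norm_mul, Complex.norm_real, Real.norm_eq_abs, abs_of_nonneg (by positivity)]
  have hw : 0 ≤ (1 / (4 * Real.pi ^ 2 * (a ^ 2 + (β + m) ^ 2)) : ℝ) := by positivity
  calc (1 / (4 * Real.pi ^ 2 * (a ^ 2 + (β + m) ^ 2)) : ℝ) * ‖c m‖ ≤ (1 / (4 * Real.pi ^ 2 * (a ^ 2 + (β + m) ^ 2)) : ℝ) * 1 :=
        mul_le_mul_of_nonneg_left (hc m) hw
    _ = 1 / (4 * Real.pi ^ 2) * (1 / (a ^ 2 + (β + ↑m) ^ 2)) := by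
        have : (a ^ 2 + (β + m) ^ 2 : ℝ) ≠ 0 := by positivity
        field_simp

/-! ## §4 The kernel as a Fourier series -/

/-- The period-`1` Fourier coefficient of `H : ℝ → ℂ` (descended by `liftIco 1 0`) is `∫₀¹ e^{−2πimx} H(x) dx` (local copy of the glue in
`…ApproxProfileFourier`). [folklore] -/
private theorem fourierCoeff_liftIco_eq_integral' (H : ℝ → ℂ) (m : ℤ) :
    fourierCoeff (AddCircle.liftIco 1 0 H) m =
      ∫ y in (0 : ℝ)..1, fourier (-m) (y : AddCircle (1 : ℝ)) * H y := by
  rw [fourierCoeff_eq_intervalIntegral _ m 0, one_div, inv_one, one_smul, zero_add]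
  refine integral_congr_Ioo_of_le zero_le_one fun y hy => ?_
  show fourier (-m) (y : AddCircle (1 : ℝ)) • AddCircle.liftIco 1 0 H (y : AddCircle (1 : ℝ)) = _
  rw [AddCircle.liftIco_coe_apply (by rw [zero_add]; exact Ioo_subset_Ico_self hy), smul_eq_mul]

/-- **The periodised line kernel is a Fourier series:** for `a > 0` and `y ∈ [0,1)`,
`Σ_{m∈ℤ} e^{2πi(β+m)y}/((2π)²(a² + (β+m)²)) = −G_{a,β}(y)` as a `HasSum` over `ℤ`, `G` the closed form of the lattice sum
`Σ_n e^{2πiβn}·(−e^{−2πa|y−n|}/(4πa))` (tree `lineKernel_hasSum`). The Fourier series of the continuous `1`-periodic function `e^{−2πiβy}G(y)`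
(coefficients `lineKernel_coeff`, summable) converges to it pointwise. [cite: Drazin2002, §8.3 (8.36)–(8.38)] -/
theorem lineKernel_fourier_hasSum {a : ℝ} (ha : 0 < a) (β : ℝ) {K : ℝ → ℂ}
    (hK : K = fun r : ℝ => (-((Real.exp (-(2 * Real.pi * a * r)) : ℂ) /
            (1 - starRingEnd ℂ (Complex.exp (2 * Real.pi * β * Complex.I)) * (Real.exp (-(2 * Real.pi * a)) : ℂ))
          + (Real.exp (2 * Real.pi * a * (r - 1)) : ℂ) * Complex.exp (2 * Real.pi * β * Complex.I) /
            (1 - Complex.exp (2 * Real.pi * β * Complex.I) * (Real.exp (-(2 * Real.pi * a)) : ℂ))) /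
        (2 * (2 * Real.pi * a) : ℂ))) {y : ℝ} (hy0 : 0 ≤ y) (hy1 : y < 1) :
    HasSum (fun m : ℤ => (((1 / (4 * Real.pi ^ 2 * (a ^ 2 + (β + m) ^ 2)) : ℝ) : ℂ)) *
        Complex.exp (2 * Real.pi * ((β : ℂ) + m) * y * Complex.I)) (-K y) := by
  set z : ℂ := Complex.exp (2 * Real.pi * β * Complex.I) with hz
  set w : ℂ := starRingEnd ℂ z with hw
  set q : ℝ := Real.exp (-(2 * Real.pi * a)) with hq
  have hπ := Real.pi_pos
  have hzn : ‖z‖ = 1 := by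
    rw [hz, show (2 * Real.pi * β * Complex.I : ℂ) = ((2 * Real.pi * β : ℝ) : ℂ) * Complex.I by push_cast; ring]
    exact Complex.norm_exp_ofReal_mul_I _
  have hwn : ‖w‖ = 1 := by rw [hw, Complex.norm_conj]; exact hzn
  have hzw : z * w = 1 := by
    rw [hw, Complex.mul_conj, Complex.normSq_eq_norm_sq, hzn]; simp
  have hq0 : 0 < q := Real.exp_pos _
  have hq1 : q < 1 := by rw [hq]; exact Real.exp_lt_one_iff.2 (by nlinarith)
  have hd1 : 1 - w * (q : ℂ) ≠ 0 := one_sub_mul_ne_zero hwn hq0.le hq1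
  have hd2 : 1 - z * (q : ℂ) ≠ 0 := one_sub_mul_ne_zero hzn hq0.le hq1
  have hκc : (2 * (2 * Real.pi * a) : ℂ) ≠ 0 := by
    have : (0 : ℝ) < 2 * (2 * Real.pi * a) := by positivity
    exact_mod_cast this.ne'
  -- the `1`-periodic continuous function `h(x) = e^{−2πiβx} K(x)`
  set h : ℝ → ℂ := fun x => Complex.exp (-(2 * Real.pi * β * x * Complex.I)) * K x with hh
  have hKc : Continuous K := by
    rw [hK]
    fun_prop
  have hhc : Continuous h := by
    rw [hh]
    fun_prop
  have hw' : Complex.exp (-(2 * Real.pi * β * Complex.I)) = w := by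
    rw [hw, hz, ← Complex.exp_conj]; congr 1
    simp only [map_mul, map_ofNat, Complex.conj_ofReal, Complex.conj_I]; ring
  have hz0 : z ≠ 0 := by rw [hz]; exact Complex.exp_ne_zero _
  have hwz : w = z⁻¹ := (inv_eq_of_mul_eq_one_right hzw).symm
  have hK0 : K 0 = -(1 / (1 - w * (q : ℂ)) + (q : ℂ) * z / (1 - z * (q : ℂ))) / (2 * (2 * Real.pi * a) : ℂ) := by
    simp only [hK, mul_zero, neg_zero, Real.exp_zero, Complex.ofReal_one, zero_sub, mul_neg_one]
    rw [← hq]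
  have hK1 : K 1 = -((q : ℂ) / (1 - w * (q : ℂ)) + z / (1 - z * (q : ℂ))) / (2 * (2 * Real.pi * a) : ℂ) := by
    simp only [hK, mul_one, sub_self, mul_zero, Real.exp_zero, Complex.ofReal_one, one_mul]
    rw [← hq]
  have h01 : h 0 = h (0 + 1) := by
    simp only [hh]
    rw [zero_add, hK0, hK1]
    simp only [Complex.ofReal_zero, mul_zero, zero_mul, neg_zero, Complex.exp_zero, one_mul, Complex.ofReal_one, mul_one]
    rw [hw', hwz]
    have hzq : z - (q : ℂ) ≠ 0 := by
      intro h0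
      have : ‖z‖ = q := by
        rw [sub_eq_zero.1 h0, Complex.norm_real, Real.norm_eq_abs, abs_of_pos hq0]
      linarith
    field_simp
    ring
  -- the continuous map on the circle and its Fourier coefficients
  set F : C(AddCircle (1 : ℝ), ℂ) := ⟨AddCircle.liftIco 1 0 h, AddCircle.liftIco_continuous h01 hhc.continuousOn⟩ with hF
  have hcoeff : ∀ m : ℤ, fourierCoeff (⇑F) m = -(((1 / (4 * Real.pi ^ 2 * (a ^ 2 + (β + m) ^ 2)) : ℝ) : ℂ)) := by
    intro m
    have e1 : (⇑F) = AddCircle.liftIco 1 0 h := rfl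
    rw [e1, fourierCoeff_liftIco_eq_integral' h m, ← lineKernel_coeff ha β m hK]
    refine intervalIntegral.integral_congr fun x _ => ?_
    simp only [hh]
    rw [fourier_coe_apply, ← mul_assoc, ← Complex.exp_add]
    congr 1; push_cast; ring
  have hsum : Summable (fourierCoeff (⇑F)) := by
    have e : fourierCoeff (⇑F) = fun m : ℤ => (((1 / (4 * Real.pi ^ 2 * (a ^ 2 + (β + m) ^ 2)) : ℝ) : ℂ)) * (-1) := by
      funext m; rw [hcoeff m]; ring
    rw [e]; exact summable_lineWeights_mul ha.ne' β (fun m => by simp)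
  have hpt := has_pointwise_sum_fourier_series_of_summable hsum (y : AddCircle (1 : ℝ))
  have hFy : F (y : AddCircle (1 : ℝ)) = h y := by
    show AddCircle.liftIco 1 0 h (y : AddCircle (1 : ℝ)) = h y
    exact AddCircle.liftIco_coe_apply (by rw [zero_add]; exact ⟨hy0, hy1⟩)
  rw [hFy] at hpt
  -- multiply by `e^{2πiβy}` and negate
  have hmul := (hpt.mul_left (-Complex.exp (2 * Real.pi * β * y * Complex.I)))
  have hlhs : -Complex.exp (2 * Real.pi * β * y * Complex.I) * h y = -K y := by
    simp only [hh]
    rw [← mul_assoc, neg_mul, ← Complex.exp_add, show (2 * Real.pi * β * y * Complex.I : ℂ) + -(2 * Real.pi * β * y * Complex.I) = 0 by ring,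
      Complex.exp_zero, neg_one_mul]
  rw [hlhs] at hmul
  refine hmul.congr_fun fun m => ?_
  rw [hcoeff m, fourier_coe_apply, smul_eq_mul]
  rw [show -Complex.exp (2 * Real.pi * β * y * Complex.I) * (-(((1 / (4 * Real.pi ^ 2 * (a ^ 2 + (β + m) ^ 2)) : ℝ) : ℂ)) *
      Complex.exp (2 * Real.pi * Complex.I * (m : ℤ) * (y : ℝ) / (1 : ℝ))) =
      (((1 / (4 * Real.pi ^ 2 * (a ^ 2 + (β + m) ^ 2)) : ℝ) : ℂ)) *
        (Complex.exp (2 * Real.pi * β * y * Complex.I) * Complex.exp (2 * Real.pi * Complex.I * (m : ℤ) * (y : ℝ) / (1 : ℝ))) by ring]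
  rw [← Complex.exp_add]
  congr 2; push_cast; ring

/-! ## §5 The two Mittag-Leffler sums of the line family -/

/-- **`Σ_{m∈ℤ} 1/(4π²(a² + (β+m)²)) = −Σ₀(a,β)/(2π)`** (`a > 0`; `Σ₀ = sawSigma0 a β < 0` is the tree's diagonal lattice sum, so this is the
classical `Σ_m 1/(a²+(β+m)²) = (π/a)·sinh 2πa/(cosh 2πa − cos 2πβ)` in the tree's `q`-form): the Fourier series of the kernel at `y = 0`
and `twoPi_lineKernel_zero`. [cite: Drazin2002, §8.3 (8.36)–(8.38)] -/
theorem hasSum_lineWeights {a : ℝ} (ha : 0 < a) (β : ℝ) :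
    HasSum (fun m : ℤ => (1 / (4 * Real.pi ^ 2 * (a ^ 2 + (β + m) ^ 2)) : ℝ)) (-sawSigma0 a β / (2 * Real.pi)) := by
  have h := lineKernel_fourier_hasSum ha β rfl le_rfl zero_lt_one
  simp only [Complex.ofReal_zero, mul_zero, zero_mul, Complex.exp_zero, mul_one, neg_zero, Real.exp_zero, Complex.ofReal_one,
    zero_sub, mul_neg_one] at h
  have h0 := twoPi_lineKernel_zero ha β
  have hz : Complex.exp (((2 * Real.pi * β : ℝ) : ℂ) * Complex.I) = Complex.exp (2 * Real.pi * β * Complex.I) := by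
    push_cast; ring_nf
  rw [hz] at h0
  have hπ : (2 * Real.pi : ℂ) ≠ 0 := by exact_mod_cast (by positivity : (0:ℝ) < 2 * Real.pi).ne'
  have hval : -(-((1 : ℂ) / (1 - starRingEnd ℂ (Complex.exp (2 * Real.pi * β * Complex.I)) * (Real.exp (-(2 * Real.pi * a)) : ℂ)) +
        (Real.exp (-(2 * Real.pi * a)) : ℂ) * Complex.exp (2 * Real.pi * β * Complex.I) /
          (1 - Complex.exp (2 * Real.pi * β * Complex.I) * (Real.exp (-(2 * Real.pi * a)) : ℂ))) / (2 * (2 * Real.pi * a) : ℂ)) =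
      (((-sawSigma0 a β / (2 * Real.pi)) : ℝ) : ℂ) := by
    have e : (-((1 : ℂ) / (1 - starRingEnd ℂ (Complex.exp (2 * Real.pi * β * Complex.I)) * (Real.exp (-(2 * Real.pi * a)) : ℂ)) +
        (Real.exp (-(2 * Real.pi * a)) : ℂ) * Complex.exp (2 * Real.pi * β * Complex.I) /
          (1 - Complex.exp (2 * Real.pi * β * Complex.I) * (Real.exp (-(2 * Real.pi * a)) : ℂ))) / (2 * (2 * Real.pi * a) : ℂ)) =
        (sawSigma0 a β : ℂ) / (2 * Real.pi) := by
      rw [eq_div_iff hπ, mul_comm]; exact h0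
    rw [e]; push_cast; ring
  rw [hval] at h
  exact Complex.hasSum_ofReal.1 h

/-- **`Σ_{m∈ℤ} e^{iπ(β+m)}/(4π²(a² + (β+m)²)) = −conj S_β(a)/(2π)`** (`a > 0`; `S_β = sawS a β` is the tree's off-diagonal lattice sum): the
Fourier series of the kernel at the partner line `y = ½` and `twoPi_conj_lineKernel_half`. [cite: Drazin2002, §8.3 (8.36)–(8.38)] -/
theorem hasSum_lineWeights_half {a : ℝ} (ha : 0 < a) (β : ℝ) :
    HasSum (fun m : ℤ => (((1 / (4 * Real.pi ^ 2 * (a ^ 2 + (β + m) ^ 2)) : ℝ) : ℂ)) * Complex.exp (Real.pi * ((β : ℂ) + m) * Complex.I))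
      (-(starRingEnd ℂ (sawS a β)) / (2 * Real.pi)) := by
  have h := lineKernel_fourier_hasSum ha β rfl (by norm_num : (0 : ℝ) ≤ 1 / 2) (by norm_num : (1 : ℝ) / 2 < 1)
  have e1 : Real.exp (-(2 * Real.pi * a * (1 / 2))) = Real.exp (-(a * Real.pi)) := by congr 1; ring
  have e2 : Real.exp (2 * Real.pi * a * (1 / 2 - 1)) = Real.exp (-(a * Real.pi)) := by congr 1; ring
  simp only [e1, e2] at h
  have h0 := twoPi_conj_lineKernel_half ha β
  have hz : Complex.exp (((2 * Real.pi * β : ℝ) : ℂ) * Complex.I) = Complex.exp (2 * Real.pi * β * Complex.I) := by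
    push_cast; ring_nf
  rw [hz] at h0
  have hπ : (2 * Real.pi : ℂ) ≠ 0 := by exact_mod_cast (by positivity : (0:ℝ) < 2 * Real.pi).ne'
  have e : starRingEnd ℂ (-((Real.exp (-(a * Real.pi)) : ℂ) /
        (1 - starRingEnd ℂ (Complex.exp (2 * Real.pi * β * Complex.I)) * (Real.exp (-(2 * Real.pi * a)) : ℂ)) +
        (Real.exp (-(a * Real.pi)) : ℂ) * Complex.exp (2 * Real.pi * β * Complex.I) /
          (1 - Complex.exp (2 * Real.pi * β * Complex.I) * (Real.exp (-(2 * Real.pi * a)) : ℂ))) / (2 * (2 * Real.pi * a) : ℂ)) =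
        sawS a β / (2 * Real.pi) := by
    rw [eq_div_iff hπ, mul_comm]; exact h0
  have e' : (-((Real.exp (-(a * Real.pi)) : ℂ) /
        (1 - starRingEnd ℂ (Complex.exp (2 * Real.pi * β * Complex.I)) * (Real.exp (-(2 * Real.pi * a)) : ℂ)) +
        (Real.exp (-(a * Real.pi)) : ℂ) * Complex.exp (2 * Real.pi * β * Complex.I) /
          (1 - Complex.exp (2 * Real.pi * β * Complex.I) * (Real.exp (-(2 * Real.pi * a)) : ℂ))) / (2 * (2 * Real.pi * a) : ℂ)) =
        starRingEnd ℂ (sawS a β) / (2 * Real.pi) := by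
    have := congrArg (starRingEnd ℂ) e
    rw [Complex.conj_conj] at this
    rw [this, map_div₀]
    congr 1
    simp only [map_mul, map_ofNat, Complex.conj_ofReal]
  rw [e', ← neg_div] at h
  refine h.congr_fun fun m => ?_
  congr 1; congr 1; push_cast; ring

/-- **`Σ_{m∈ℤ} e^{−iπ(β+m)}/(4π²(a² + (β+m)²)) = −S_β(a)/(2π)`** (`a > 0`): the conjugate of `hasSum_lineWeights_half` (the weights are real).
[cite: Drazin2002, §8.3 (8.36)–(8.38)] -/
theorem hasSum_lineWeights_half' {a : ℝ} (ha : 0 < a) (β : ℝ) :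
    HasSum (fun m : ℤ => (((1 / (4 * Real.pi ^ 2 * (a ^ 2 + (β + m) ^ 2)) : ℝ) : ℂ)) * Complex.exp (-(Real.pi * ((β : ℂ) + m) * Complex.I)))
      (-(sawS a β) / (2 * Real.pi)) := by
  have h := Complex.hasSum_conj'.2 (hasSum_lineWeights_half ha β)
  have hv : starRingEnd ℂ (-(starRingEnd ℂ (sawS a β)) / (2 * Real.pi)) = -(sawS a β) / (2 * Real.pi) := by
    rw [map_div₀, map_neg, Complex.conj_conj]
    congr 1
    simp only [map_mul, map_ofNat, Complex.conj_ofReal]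
  rw [hv] at h
  refine h.congr_fun fun m => ?_
  show _ = starRingEnd ℂ _
  rw [map_mul, Complex.conj_ofReal, ← Complex.exp_conj]
  congr 2
  simp only [map_mul, map_add, Complex.conj_ofReal, map_intCast, Complex.conj_I]
  ring

end Summit.AnomalousDissipation.AnomalousDissipation.Theorems.SawtoothPulseCascade.K2PhaseBudget

end
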